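import Summits.NavierStokesRegularity.NavierStokesRegularity.Theorems.ExtremiserTransienceNearExtremalTransienceExtremiserLiouvilleConstantSpeedKKT
import Literature.Analysis.FluidPDE.VorticityCalculus
import Literature.Analysis.FluidPDE.PeriodicLerayProfileGradient
import Mathlib.Topology.Algebra.ConstMulAction
import HarnessLib

/-!
# Crux `ExtremiserTransience.NearExtremalTransience` (stmt-NavierStokesRegularity-21883), line `extremiser_liouville`,
# stub K1b — KKT TAIL CONDITION, tools: the rescaled test family `φ_R(x) = Φ(x/R)`

`--supports stmt-NavierStokesRegularity-21883` (helper).  Author: prover seat `ns-el-k1b` (g4).  Tools for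
`…ConstantSpeedKKTTail`: for a profile `Φ : ℝ³ → ℝ³` and `R ≠ 0`, the rescaled field `x ↦ Φ(R⁻¹x)` — derivative
`R⁻¹·DΦ(R⁻¹x)` (`hasFDerivAt_rescale`), smoothness, compact support, divergence-freeness, `curl φ_R = R⁻¹(curl Φ)(R⁻¹x)`,
`D curl φ_R = R⁻²(D curl Φ)(R⁻¹x)`; compactly supported smooth profiles have bounded `curl`, `DΦ`, `D curl Φ`; and the
Young-type bound `Σ⟪A bᵢ, B bᵢ⟫ ≤ (η/2)|A|²_F + |B|²_F/(2η)` (the Frobenius bound `|L|²_F ≤ 3‖L‖²` is the tree's `BradshawTsai2017.frobeniusNormSq_le_three_mul_norm_sq`).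

WHAT THIS IS NOT: K1b is NOT proved; nothing here proves NS regularity. [folklore]
-/

noncomputable section

open Set Filter Topology MeasureTheory Metric Function
open scoped ENNReal NNReal Topology InnerProductSpace RealInnerProductSpace ContDiff
open Literature.Analysis.FluidPDE Literature.Analysis

namespace Summit.NavierStokesRegularity.NavierStokesRegularity.Theorems

-- the problem directory repeats the summit name (`NavierStokesRegularity/NavierStokesRegularity`)
set_option linter.dupNamespace false

namespace ExtremiserLiouville

variable {Φ : EuclideanSpace ℝ (Fin 3) → EuclideanSpace ℝ (Fin 3)}

/-! ## The rescaled family -/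

/-- `D(Φ(R⁻¹·))(x) = R⁻¹ · DΦ(R⁻¹x)`. [folklore] -/
theorem hasFDerivAt_rescale (hΦ : Differentiable ℝ Φ) (R : ℝ) (x : EuclideanSpace ℝ (Fin 3)) :
    HasFDerivAt (fun x => Φ (R⁻¹ • x)) (R⁻¹ • fderiv ℝ Φ (R⁻¹ • x)) x := by
  have h1 : HasFDerivAt (fun x : EuclideanSpace ℝ (Fin 3) => R⁻¹ • x)
      (R⁻¹ • ContinuousLinearMap.id ℝ (EuclideanSpace ℝ (Fin 3))) x := (hasFDerivAt_id x).const_smul R⁻¹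
  refine ((hΦ (R⁻¹ • x)).hasFDerivAt.comp x h1).congr_fderiv ?_
  refine ContinuousLinearMap.ext fun w => ?_
  simp

/-- `fderiv` of the rescaled field. [folklore] -/
theorem fderiv_rescale (hΦ : Differentiable ℝ Φ) (R : ℝ) (x : EuclideanSpace ℝ (Fin 3)) :
    fderiv ℝ (fun x => Φ (R⁻¹ • x)) x = R⁻¹ • fderiv ℝ Φ (R⁻¹ • x) :=
  (hasFDerivAt_rescale hΦ R x).fderiv

/-- The rescaled field is `Cⁿ`. [folklore] -/
theorem contDiff_rescale {n : WithTop ℕ∞} (hΦ : ContDiff ℝ n Φ) (R : ℝ) : ContDiff ℝ n fun x => Φ (R⁻¹ • x) :=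
  hΦ.comp (contDiff_id.const_smul R⁻¹)

/-- The rescaled field has compact support (`R ≠ 0`). [folklore] -/
theorem hasCompactSupport_rescale (hΦc : HasCompactSupport Φ) {R : ℝ} (hR : R ≠ 0) :
    HasCompactSupport fun x => Φ (R⁻¹ • x) :=
  hΦc.comp_smul (inv_ne_zero hR)

/-- The rescaled field is divergence free if `Φ` is. [folklore] -/
theorem isDivFree_rescale (hΦ : Differentiable ℝ Φ) (hdiv : VectorCalculus.IsDivFree Φ) (R : ℝ) :
    VectorCalculus.IsDivFree fun x => Φ (R⁻¹ • x) := by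
  intro x
  have h := hdiv (R⁻¹ • x)
  simp only [VectorCalculus.divergence] at h ⊢
  rw [fderiv_rescale hΦ, ContinuousLinearMap.toLinearMap_smul, map_smul, h, smul_zero]

/-- `curl φ_R (x) = R⁻¹ · (curl Φ)(R⁻¹x)`. [folklore] -/
theorem curl_rescale (hΦ : Differentiable ℝ Φ) (R : ℝ) (x : EuclideanSpace ℝ (Fin 3)) :
    curl (fun x => Φ (R⁻¹ • x)) x = R⁻¹ • curl Φ (R⁻¹ • x) := by
  rw [curl_eq_curlCLM, fderiv_rescale hΦ, map_smul, ← curl_eq_curlCLM]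

/-- `D curl φ_R (x) = R⁻¹ · R⁻¹ · (D curl Φ)(R⁻¹x)`. [folklore] -/
theorem fderiv_curl_rescale (hΦ : ContDiff ℝ 2 Φ) (R : ℝ) (x : EuclideanSpace ℝ (Fin 3)) :
    fderiv ℝ (curl fun x => Φ (R⁻¹ • x)) x = R⁻¹ • (R⁻¹ • fderiv ℝ (curl Φ) (R⁻¹ • x)) := by
  have hΦd : Differentiable ℝ Φ := hΦ.differentiable (by norm_num)
  have hcd : Differentiable ℝ (curl Φ) := (contDiff_curl (n := 1) hΦ).differentiable one_ne_zero
  have e : (curl fun x => Φ (R⁻¹ • x)) = fun x => R⁻¹ • curl Φ (R⁻¹ • x) := funext (curl_rescale hΦd R)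
  have hd : DifferentiableAt ℝ (fun x => curl Φ (R⁻¹ • x)) x := (hasFDerivAt_rescale hcd R x).differentiableAt
  rw [e, fderiv_fun_const_smul hd]
  congr 1
  exact fderiv_rescale hcd R x

/-! ## Bounds for compactly supported smooth profiles -/

/-- `curl Φ`, `DΦ` and `D curl Φ` are bounded for a compactly supported `C²` profile. [folklore] -/
theorem exists_bounds_of_profile (hΦ : ContDiff ℝ 2 Φ) (hΦc : HasCompactSupport Φ) :
    ∃ C : ℝ, 0 ≤ C ∧ (∀ y, ‖Φ y‖ ≤ C) ∧ (∀ y, ‖curl Φ y‖ ≤ C) ∧ (∀ y, ‖fderiv ℝ Φ y‖ ≤ C) ∧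
      ∀ y, ‖fderiv ℝ (curl Φ) y‖ ≤ C := by
  have hD : HasCompactSupport (fderiv ℝ Φ) := hΦc.fderiv (𝕜 := ℝ)
  have hcurl : HasCompactSupport (curl Φ) := by
    rw [curl_eq_curlCLM_comp]; exact hD.comp_left (map_zero _)
  have hDcurl : HasCompactSupport (fderiv ℝ (curl Φ)) := hcurl.fderiv (𝕜 := ℝ)
  obtain ⟨C₀, hC₀⟩ := hΦ.continuous.bounded_above_of_compact_support hΦc
  obtain ⟨C₁, hC₁⟩ := (continuous_curl (hΦ.of_le (by norm_num))).bounded_above_of_compact_support hcurl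
  obtain ⟨C₂, hC₂⟩ := (hΦ.continuous_fderiv (by norm_num)).bounded_above_of_compact_support hD
  obtain ⟨C₃, hC₃⟩ := ((contDiff_curl (n := 1) hΦ).continuous_fderiv one_ne_zero).bounded_above_of_compact_support hDcurl
  set C : ℝ := max (max (max C₀ C₁) (max C₂ C₃)) 0 with hC
  have h0 : C₀ ≤ C := (le_max_left _ _).trans ((le_max_left _ _).trans (le_max_left _ _))
  have h1 : C₁ ≤ C := (le_max_right _ _).trans ((le_max_left _ _).trans (le_max_left _ _))
  have h2 : C₂ ≤ C := (le_max_left _ _).trans ((le_max_right _ _).trans (le_max_left _ _))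
  have h3 : C₃ ≤ C := (le_max_right _ _).trans ((le_max_right _ _).trans (le_max_left _ _))
  exact ⟨C, le_max_right _ _, fun y => (hC₀ y).trans h0, fun y => (hC₁ y).trans h1, fun y => (hC₂ y).trans h2,
    fun y => (hC₃ y).trans h3⟩

/-- The cross terms `Σᵢ ⟪A bᵢ, B bᵢ⟫` are bounded by `(η/2)·|A|²_F + (1/(2η))·|B|²_F` (`η > 0`). [folklore] -/
theorem sum_inner_le_frobeniusNormSq (A B : EuclideanSpace ℝ (Fin 3) →L[ℝ] EuclideanSpace ℝ (Fin 3)) {η : ℝ}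
    (hη : 0 < η) :
    |∑ i, ⟪A (EuclideanSpace.basisFun (Fin 3) ℝ i), B (EuclideanSpace.basisFun (Fin 3) ℝ i)⟫| ≤
      η / 2 * frobeniusNormSq A + 1 / (2 * η) * frobeniusNormSq B := by
  rw [frobeniusNormSq_eq_sum (EuclideanSpace.basisFun (Fin 3) ℝ), frobeniusNormSq_eq_sum (EuclideanSpace.basisFun (Fin 3) ℝ),
    Finset.mul_sum, Finset.mul_sum, ← Finset.sum_add_distrib]
  refine (Finset.abs_sum_le_sum_abs _ _).trans (Finset.sum_le_sum fun i _ => ?_)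
  set a := A (EuclideanSpace.basisFun (Fin 3) ℝ i)
  set b := B (EuclideanSpace.basisFun (Fin 3) ℝ i)
  have h1 : |⟪a, b⟫| ≤ ‖a‖ * ‖b‖ := abs_real_inner_le_norm a b
  have h2 : ‖a‖ * ‖b‖ ≤ η / 2 * ‖a‖ ^ 2 + 1 / (2 * η) * ‖b‖ ^ 2 := by
    have h := sq_nonneg (η * ‖a‖ - ‖b‖)
    have e : η / 2 * ‖a‖ ^ 2 + 1 / (2 * η) * ‖b‖ ^ 2 - ‖a‖ * ‖b‖ = (η * ‖a‖ - ‖b‖) ^ 2 / (2 * η) := by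
      field_simp; ring
    have : 0 ≤ (η * ‖a‖ - ‖b‖) ^ 2 / (2 * η) := by positivity
    linarith
  exact h1.trans h2

end ExtremiserLiouville

end Summit.NavierStokesRegularity.NavierStokesRegularity.Theorems

end
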